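import Mathlib
import HarnessLib
import Literature.MathematicalPhysics.QuantumFieldTheory.GaussianToolkit
import Literature.MathematicalPhysics.QuantumFieldTheory.Balaban1983to89.Beta.GaussianIntegral

/-!
# Gaussian expectation of the exponential of a linear-plus-quadratic form
# ("general Gaussian calculus", Adams–Buchholz–Kotecký–Müller (7.8))

The large-field weights `w_k^X = e^{½(A_k^X φ, φ)}` of the multiscale analysis of gradient models
are propagated through the Gaussian integrations `μ_{C_{k+1}}` by the identity ([ABKM19] (7.8))

`∫ e^{½(A(φ+ψ), φ+ψ)} μ_C(dψ) = det(1 − C^{1/2} A C^{1/2})^{−1/2} · e^{½((A^{−1} − C)^{−1} φ, φ)}`,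

"by general Gaussian calculus … under the assumption that `A < C^{−1}`".  This file proves the
underlying computation in the generality the renormalisation group needs (the covariances `C_k` of a
finite-range decomposition are DEGENERATE, so the covariance enters through its square root
`C^{1/2}`, never through `C^{−1}`):

* `integral_exp_neg_half_quadForm_add_dotProduct` — completing the square:
  `∫_{ℝ^ι} e^{−½ vᵀQv + bᵀv} dv = √(2π)^{|ι|} / √(det Q) · e^{½ bᵀQ⁻¹b}` for `Q` positive definite
  (from the tree's `∫ e^{−½ vᵀQv} dv = √(2π)^{|ι|}/√det Q`, `Beta.GaussianIntegral.integral_exp_neg_half_quadForm`,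
  and the translation invariance of Lebesgue measure), with integrability;
* `integral_exp_dotProduct_add_half_quadForm_mul_gaussWeight` — precision form: for `P − M`
  positive definite, `∫ e^{bᵀv + ½vᵀMv} e^{−½vᵀPv} dv = √(2π)^{|ι|}/√det(P − M) · e^{½ bᵀ(P−M)⁻¹b}`;
* **`integral_exp_dotProduct_add_half_quadForm_stdGaussian`** — for Mathlib's standard Gaussian
  on Euclidean `ℝ^ι` and `1 − M` positive definite,
  `E[e^{bᵀZ + ½ZᵀMZ}] = (det(1 − M))^{−1/2} · e^{½ bᵀ(1−M)⁻¹b}`;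
* **`integral_exp_dotProduct_add_half_quadForm_multivariateGaussian`** — for Mathlib's
  `multivariateGaussian 0 S` (ANY `S`; for `S` not positive semidefinite Mathlib's measure is `δ_0`
  and `√S = 0`, and the identity still holds) and `1 − √S M √S` positive definite,
  `E_{N(0,S)}[e^{bᵀx + ½xᵀMx}] = (det(1 − √S M √S))^{−1/2} · e^{½ (√S b)ᵀ(1 − √S M √S)⁻¹(√S b)}`,
  which is [ABKM19] (7.8) at `b = Aφ`, `M = A` after expanding `(A(φ+ψ), φ+ψ)`
  (`integral_exp_half_quadForm_shift_multivariateGaussian`).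

Everything is proved; no named fact.  What is NOT here: the rewriting
`(Aφ,φ) + (√C Aφ, (1−√CA√C)⁻¹ √C Aφ) = ((A⁻¹ − C)⁻¹ φ, φ)` for invertible `A` (the source itself
calls the `(A⁻¹ − C)⁻¹` form "a bit sloppy because `A_k^X` is in general not invertible",
Ch. 7.1), the determinant bound `det(1 − B)^{−1/2} ≤ e^{tr B/(2(1−‖B‖))}` of [ABKM19] Lemma 7.5, and
the transport to the field-space Gaussian `LongRangePhi4.fieldGaussian` (`= N(0, C ⊗ 1)` transported).

## References
* S. Adams, S. Buchholz, R. Kotecký, S. Müller, arXiv:1910.13564, Ch. 7.1, display (7.8)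
  [AdamsBuchholzKoteckyMuller2019].
* J. Glimm, A. Jaffe, *Quantum Physics*, §9.1 (Gaussian integrals). [folklore form]
-/

noncomputable section

open MeasureTheory ProbabilityTheory WithLp Matrix
open scoped ENNReal Matrix MatrixOrder

namespace Literature.MathematicalPhysics.QuantumFieldTheory

open Literature.MathematicalPhysics.QuantumFieldTheory.Balaban1983to89.Beta

variable {ι : Type*} [Fintype ι] [DecidableEq ι]

/-! ## Completing the square on `ι → ℝ` -/

/-- Completing the square: for symmetric invertible `Q` and `u = Q⁻¹ b`,
`−½ vᵀQv + bᵀv = −½ (v−u)ᵀQ(v−u) + ½ bᵀQ⁻¹b`. [cite: AdamsBuchholzKoteckyMuller2019, Ch. 7.1 (7.8) ("general Gaussian calculus")] -/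
theorem neg_half_quadForm_add_dotProduct_eq {Q : Matrix ι ι ℝ} (hQ : Q.PosDef) (b v : ι → ℝ) :
    -(1/2 : ℝ) * (v ⬝ᵥ Q *ᵥ v) + b ⬝ᵥ v =
      -(1/2 : ℝ) * ((v - Q⁻¹ *ᵥ b) ⬝ᵥ Q *ᵥ (v - Q⁻¹ *ᵥ b)) + (1/2 : ℝ) * (b ⬝ᵥ Q⁻¹ *ᵥ b) := by
  have hQu : IsUnit Q.det := (Matrix.isUnit_iff_isUnit_det _).1 hQ.isUnit
  have hsymm : Qᵀ = Q := by
    have h := hQ.isHermitian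
    rwa [Matrix.IsHermitian, Matrix.conjTranspose_eq_transpose_of_trivial] at h
  -- `Q (Q⁻¹ b) = b`
  have h1 : Q *ᵥ (Q⁻¹ *ᵥ b) = b := by
    rw [Matrix.mulVec_mulVec, Matrix.mul_nonsing_inv _ hQu, Matrix.one_mulVec]
  -- `(Q⁻¹ b)ᵀ Q w = bᵀ w` (symmetry of `Q`)
  have h2 : ∀ w : ι → ℝ, (Q⁻¹ *ᵥ b) ⬝ᵥ Q *ᵥ w = b ⬝ᵥ w := by
    intro w
    rw [Matrix.dotProduct_mulVec, ← Matrix.mulVec_transpose, hsymm, h1]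
  rw [Matrix.mulVec_sub, h1, sub_dotProduct, dotProduct_sub, dotProduct_sub, h2 v,
    dotProduct_comm (Q⁻¹ *ᵥ b) b, dotProduct_comm v b]
  ring

/-- **Gaussian integral with a linear term** (completing the square + translation invariance of
Lebesgue measure): for `Q` positive definite,
`∫_{ℝ^ι} e^{−½ vᵀQv + bᵀv} dv = √(2π)^{|ι|} / √(det Q) · e^{½ bᵀQ⁻¹b}`.
[cite: AdamsBuchholzKoteckyMuller2019, Ch. 7.1 (7.8) ("general Gaussian calculus")] -/
theorem integral_exp_neg_half_quadForm_add_dotProduct {Q : Matrix ι ι ℝ} (hQ : Q.PosDef)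
    (b : ι → ℝ) :
    ∫ v : ι → ℝ, Real.exp (-(1/2 : ℝ) * (v ⬝ᵥ Q *ᵥ v) + b ⬝ᵥ v) =
      Real.sqrt (2 * Real.pi) ^ Fintype.card ι / Real.sqrt Q.det *
        Real.exp ((1/2 : ℝ) * (b ⬝ᵥ Q⁻¹ *ᵥ b)) := by
  have h : ∀ v : ι → ℝ, Real.exp (-(1/2 : ℝ) * (v ⬝ᵥ Q *ᵥ v) + b ⬝ᵥ v) =
      (fun w : ι → ℝ => Real.exp (-(1/2 : ℝ) * (w ⬝ᵥ Q *ᵥ w))) (v - Q⁻¹ *ᵥ b) *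
        Real.exp ((1/2 : ℝ) * (b ⬝ᵥ Q⁻¹ *ᵥ b)) := by
    intro v
    rw [neg_half_quadForm_add_dotProduct_eq hQ, Real.exp_add]
  simp_rw [h]
  rw [integral_mul_const, integral_sub_right_eq_self
    (fun w : ι → ℝ => Real.exp (-(1/2 : ℝ) * (w ⬝ᵥ Q *ᵥ w))) (Q⁻¹ *ᵥ b),
    GaussianIntegral.integral_exp_neg_half_quadForm Q hQ]

/-- Integrability of `e^{−½ vᵀQv + bᵀv}` for `Q` positive definite.
[cite: AdamsBuchholzKoteckyMuller2019, Ch. 7.1 (7.8) ("general Gaussian calculus")] -/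
theorem integrable_exp_neg_half_quadForm_add_dotProduct {Q : Matrix ι ι ℝ} (hQ : Q.PosDef)
    (b : ι → ℝ) :
    Integrable (fun v : ι → ℝ => Real.exp (-(1/2 : ℝ) * (v ⬝ᵥ Q *ᵥ v) + b ⬝ᵥ v)) := by
  have h : (fun v : ι → ℝ => Real.exp (-(1/2 : ℝ) * (v ⬝ᵥ Q *ᵥ v) + b ⬝ᵥ v)) =
      fun v => (fun w : ι → ℝ => Real.exp (-(1/2 : ℝ) * (w ⬝ᵥ Q *ᵥ w))) (v - Q⁻¹ *ᵥ b) *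
        Real.exp ((1/2 : ℝ) * (b ⬝ᵥ Q⁻¹ *ᵥ b)) := by
    funext v
    rw [neg_half_quadForm_add_dotProduct_eq hQ, Real.exp_add]
  rw [h]
  exact ((GaussianIntegral.integrable_exp_neg_half_quadForm Q hQ).comp_sub_right (Q⁻¹ *ᵥ b)).mul_const _

/-! ## Precision form: the Gaussian weight `e^{−½ vᵀPv}` -/

/-- **Linear-plus-quadratic exponential against a Gaussian weight** (precision form): if `P − M` is
positive definite then
`∫ e^{bᵀv + ½ vᵀMv} e^{−½ vᵀPv} dv = √(2π)^{|ι|} / √det(P − M) · e^{½ bᵀ(P−M)⁻¹ b}`.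
[cite: AdamsBuchholzKoteckyMuller2019, Ch. 7.1 (7.8) ("general Gaussian calculus")] -/
theorem integral_exp_dotProduct_add_half_quadForm_mul_gaussWeight {P M : Matrix ι ι ℝ}
    (hPM : (P - M).PosDef) (b : ι → ℝ) :
    ∫ v : ι → ℝ, Real.exp (b ⬝ᵥ v + (1/2 : ℝ) * (v ⬝ᵥ M *ᵥ v)) *
        Real.exp (-(1/2 : ℝ) * (v ⬝ᵥ P *ᵥ v)) =
      Real.sqrt (2 * Real.pi) ^ Fintype.card ι / Real.sqrt (P - M).det *
        Real.exp ((1/2 : ℝ) * (b ⬝ᵥ (P - M)⁻¹ *ᵥ b)) := by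
  have h : ∀ v : ι → ℝ, Real.exp (b ⬝ᵥ v + (1/2 : ℝ) * (v ⬝ᵥ M *ᵥ v)) *
      Real.exp (-(1/2 : ℝ) * (v ⬝ᵥ P *ᵥ v)) =
      Real.exp (-(1/2 : ℝ) * (v ⬝ᵥ (P - M) *ᵥ v) + b ⬝ᵥ v) := by
    intro v
    rw [← Real.exp_add, Matrix.sub_mulVec, dotProduct_sub]
    congr 1
    ring
  simp_rw [h]
  exact integral_exp_neg_half_quadForm_add_dotProduct hPM b

/-- Integrability in the precision form.
[cite: AdamsBuchholzKoteckyMuller2019, Ch. 7.1 (7.8) ("general Gaussian calculus")] -/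
theorem integrable_exp_dotProduct_add_half_quadForm_mul_gaussWeight {P M : Matrix ι ι ℝ}
    (hPM : (P - M).PosDef) (b : ι → ℝ) :
    Integrable (fun v : ι → ℝ => Real.exp (b ⬝ᵥ v + (1/2 : ℝ) * (v ⬝ᵥ M *ᵥ v)) *
        Real.exp (-(1/2 : ℝ) * (v ⬝ᵥ P *ᵥ v))) := by
  have h : (fun v : ι → ℝ => Real.exp (b ⬝ᵥ v + (1/2 : ℝ) * (v ⬝ᵥ M *ᵥ v)) *
      Real.exp (-(1/2 : ℝ) * (v ⬝ᵥ P *ᵥ v))) =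
      fun v => Real.exp (-(1/2 : ℝ) * (v ⬝ᵥ (P - M) *ᵥ v) + b ⬝ᵥ v) := by
    funext v
    rw [← Real.exp_add, Matrix.sub_mulVec, dotProduct_sub]
    congr 1
    ring
  rw [h]
  exact integrable_exp_neg_half_quadForm_add_dotProduct hPM b

/-- **Normalised precision form** (`N(0, P⁻¹)` as the normalised weight `e^{−½vᵀPv}dv / Z_P`): for `P`
and `P − M` positive definite,
`(∫ e^{−½vᵀPv} dv)⁻¹ ∫ e^{bᵀv + ½vᵀMv} e^{−½vᵀPv} dv = √(det P) / √(det(P−M)) · e^{½ bᵀ(P−M)⁻¹b}`.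
[cite: AdamsBuchholzKoteckyMuller2019, Ch. 7.1 (7.8) ("general Gaussian calculus")] -/
theorem integral_exp_dotProduct_add_half_quadForm_gaussian_precision {P M : Matrix ι ι ℝ}
    (hP : P.PosDef) (hPM : (P - M).PosDef) (b : ι → ℝ) :
    (∫ v : ι → ℝ, Real.exp (-(1/2 : ℝ) * (v ⬝ᵥ P *ᵥ v)))⁻¹ *
        ∫ v : ι → ℝ, Real.exp (b ⬝ᵥ v + (1/2 : ℝ) * (v ⬝ᵥ M *ᵥ v)) *
          Real.exp (-(1/2 : ℝ) * (v ⬝ᵥ P *ᵥ v)) =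
      Real.sqrt P.det / Real.sqrt (P - M).det *
        Real.exp ((1/2 : ℝ) * (b ⬝ᵥ (P - M)⁻¹ *ᵥ b)) := by
  rw [integral_exp_dotProduct_add_half_quadForm_mul_gaussWeight hPM,
    GaussianIntegral.integral_exp_neg_half_quadForm P hP]
  have hπ : 0 < Real.sqrt (2 * Real.pi) ^ Fintype.card ι :=
    pow_pos (Real.sqrt_pos.2 (by positivity)) _
  have hdP : 0 < Real.sqrt P.det := Real.sqrt_pos.2 hP.det_pos
  field_simp

/-! ## Mathlib's standard Gaussian on Euclidean `ℝ^ι` -/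

omit [DecidableEq ι] in
/-- Quadratic forms transform under a linear map by congruence:
`(Av)ᵀ M (Av) = vᵀ (Aᵀ M A) v`. [cite: AdamsBuchholzKoteckyMuller2019, Ch. 7.1 (7.8) ("general Gaussian calculus")] -/
theorem mulVec_dotProduct_mulVec_mulVec (A M : Matrix ι ι ℝ) (v : ι → ℝ) :
    (A *ᵥ v) ⬝ᵥ M *ᵥ (A *ᵥ v) = v ⬝ᵥ (Aᵀ * M * A) *ᵥ v := by
  rw [← Matrix.mulVec_mulVec, ← Matrix.mulVec_mulVec, Matrix.dotProduct_mulVec v Aᵀ,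
    Matrix.vecMul_transpose]

omit [DecidableEq ι] in
/-- Linear forms transform by the transpose: `bᵀ(Av) = (Aᵀb)ᵀ v`.
[cite: AdamsBuchholzKoteckyMuller2019, Ch. 7.1 (7.8) ("general Gaussian calculus")] -/
theorem dotProduct_mulVec_eq_transpose_mulVec_dotProduct (A : Matrix ι ι ℝ) (b v : ι → ℝ) :
    b ⬝ᵥ (A *ᵥ v) = (Aᵀ *ᵥ b) ⬝ᵥ v := by
  rw [Matrix.dotProduct_mulVec, Matrix.mulVec_transpose]

/-- **MGF of a linear-plus-quadratic form under the standard Gaussian** on Euclidean `ℝ^ι`: if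
`1 − M` is positive definite then
`E[e^{bᵀZ + ½ ZᵀMZ}] = (√det(1 − M))⁻¹ · e^{½ bᵀ(1−M)⁻¹ b}`.
[cite: AdamsBuchholzKoteckyMuller2019, Ch. 7.1 (7.8) ("general Gaussian calculus")] -/
theorem integral_exp_dotProduct_add_half_quadForm_stdGaussian {M : Matrix ι ι ℝ}
    (hM : ((1 : Matrix ι ι ℝ) - M).PosDef) (b : ι → ℝ) :
    ∫ x, Real.exp (b ⬝ᵥ ofLp x + (1/2 : ℝ) * (ofLp x ⬝ᵥ M *ᵥ ofLp x))
        ∂(stdGaussian (EuclideanSpace ℝ ι)) =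
      (Real.sqrt ((1 : Matrix ι ι ℝ) - M).det)⁻¹ *
        Real.exp ((1/2 : ℝ) * (b ⬝ᵥ ((1 : Matrix ι ι ℝ) - M)⁻¹ *ᵥ b)) := by
  set F : (ι → ℝ) → ℝ := fun v => Real.exp (b ⬝ᵥ v + (1/2 : ℝ) * (v ⬝ᵥ M *ᵥ v)) with hF
  -- pull back to the product Gaussian on `ι → ℝ`
  have h1 : ∫ x, Real.exp (b ⬝ᵥ ofLp x + (1/2 : ℝ) * (ofLp x ⬝ᵥ M *ᵥ ofLp x))
      ∂(stdGaussian (EuclideanSpace ℝ ι)) =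
      ∫ v, F v ∂(Measure.pi fun _ : ι => gaussianReal 0 1) := by
    rw [← map_pi_eq_stdGaussian, ← MeasurableEquiv.coe_toLp, integral_map_equiv]
    rfl
  -- the product Gaussian is the density `(2π)^{-|ι|/2} e^{-|v|²/2}`
  have h2 : ∫ v, F v ∂(Measure.pi fun _ : ι => gaussianReal 0 1) =
      ∫ v : ι → ℝ, ((Real.sqrt (2 * Real.pi))⁻¹ ^ Fintype.card ι *
        Real.exp (-(∑ i, v i ^ 2) / 2)) * F v := by
    have hmeas : Measurable (fun x : ι → ℝ => ∏ i, gaussianPDF 0 1 (x i)) :=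
      Finset.measurable_prod _ fun i _ => (measurable_gaussianPDF 0 1).comp (measurable_pi_apply i)
    have hfin : ∀ᵐ x ∂(volume : Measure (ι → ℝ)), (∏ i, gaussianPDF 0 1 (x i)) < ∞ :=
      Filter.Eventually.of_forall fun v => by
        rw [GaussianToolkit.prod_gaussianPDF_eq]; exact ENNReal.ofReal_lt_top
    rw [GaussianToolkit.pi_gaussianReal_eq_withDensity,
      integral_withDensity_eq_integral_toReal_smul hmeas hfin]
    refine integral_congr_ae (Filter.Eventually.of_forall fun v => ?_)
    simp only []
    rw [GaussianToolkit.prod_gaussianPDF_eq, ENNReal.toReal_ofReal (by positivity), smul_eq_mul]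
  -- `e^{-|v|²/2} F(v) = e^{bᵀv + ½vᵀMv} e^{-½ vᵀ 1 v}`
  have h3 : ∀ v : ι → ℝ, ((Real.sqrt (2 * Real.pi))⁻¹ ^ Fintype.card ι *
      Real.exp (-(∑ i, v i ^ 2) / 2)) * F v =
      (Real.sqrt (2 * Real.pi))⁻¹ ^ Fintype.card ι *
        (Real.exp (b ⬝ᵥ v + (1/2 : ℝ) * (v ⬝ᵥ M *ᵥ v)) *
          Real.exp (-(1/2 : ℝ) * (v ⬝ᵥ (1 : Matrix ι ι ℝ) *ᵥ v))) := by
    intro v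
    have hq : v ⬝ᵥ (1 : Matrix ι ι ℝ) *ᵥ v = ∑ i, v i ^ 2 := by
      rw [Matrix.one_mulVec, dotProduct]
      exact Finset.sum_congr rfl fun i _ => by ring
    rw [hq, hF]
    have : Real.exp (-(∑ i, v i ^ 2) / 2) = Real.exp (-(1/2 : ℝ) * ∑ i, v i ^ 2) := by
      congr 1; ring
    rw [this]
    ring
  rw [h1, h2]
  simp_rw [h3]
  rw [integral_const_mul, integral_exp_dotProduct_add_half_quadForm_mul_gaussWeight hM b]
  have hπ : 0 < Real.sqrt (2 * Real.pi) := Real.sqrt_pos.2 (by positivity)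
  rw [inv_pow]
  field_simp

/-! ## Mathlib's `multivariateGaussian 0 S`: the covariance through its square root -/

/-- **MGF of a linear-plus-quadratic form under `N(0, S)`** ([ABKM19] (7.8) in square-root form,
valid for DEGENERATE covariances): for every real matrix `S` (Mathlib's `multivariateGaussian 0 S` is
the image of the standard Gaussian under `x ↦ √S x`, `√S = CFC.sqrt S`) and every `M` with
`1 − √S M √S` positive definite,
`E_{N(0,S)}[e^{bᵀx + ½ xᵀMx}] = (√det(1 − √S M √S))⁻¹ · e^{½ (√S b)ᵀ (1 − √S M √S)⁻¹ (√S b)}`.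
[cite: AdamsBuchholzKoteckyMuller2019, Ch. 7.1 (7.8) ("general Gaussian calculus")] -/
theorem integral_exp_dotProduct_add_half_quadForm_multivariateGaussian (S : Matrix ι ι ℝ)
    {M : Matrix ι ι ℝ} (hM : ((1 : Matrix ι ι ℝ) - CFC.sqrt S * M * CFC.sqrt S).PosDef)
    (b : ι → ℝ) :
    ∫ x, Real.exp (b ⬝ᵥ ofLp x + (1/2 : ℝ) * (ofLp x ⬝ᵥ M *ᵥ ofLp x))
        ∂(multivariateGaussian 0 S) =
      (Real.sqrt ((1 : Matrix ι ι ℝ) - CFC.sqrt S * M * CFC.sqrt S).det)⁻¹ *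
        Real.exp ((1/2 : ℝ) * ((CFC.sqrt S *ᵥ b) ⬝ᵥ
          ((1 : Matrix ι ι ℝ) - CFC.sqrt S * M * CFC.sqrt S)⁻¹ *ᵥ (CFC.sqrt S *ᵥ b))) := by
  set R : Matrix ι ι ℝ := CFC.sqrt S with hR
  have hRt : Rᵀ = R := GaussianToolkit.transpose_sqrt (S := S)
  -- `N(0,S)` is the image of the standard Gaussian under `x ↦ R x`
  have hmap : multivariateGaussian 0 S =
      (stdGaussian (EuclideanSpace ℝ ι)).map (toEuclideanCLM (n := ι) (𝕜 := ℝ) R) := by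
    rw [multivariateGaussian]
    congr 1
    funext x
    rw [zero_add, ← hR]
  have hcont : Continuous fun x : EuclideanSpace ℝ ι =>
      Real.exp (b ⬝ᵥ ofLp x + (1/2 : ℝ) * (ofLp x ⬝ᵥ M *ᵥ ofLp x)) := by
    have hc : Continuous fun x : EuclideanSpace ℝ ι => (ofLp x : ι → ℝ) := PiLp.continuous_ofLp 2 _
    refine Real.continuous_exp.comp ((continuous_const.dotProduct hc).add
      (continuous_const.mul (hc.dotProduct (continuous_const.matrix_mulVec hc))))
  rw [hmap, integral_map (toEuclideanCLM (n := ι) (𝕜 := ℝ) R).continuous.measurable.aemeasurable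
    hcont.aestronglyMeasurable]
  -- in coordinates: `x ↦ R x`, so the exponent becomes `(Rb)ᵀz + ½ zᵀ(R M R)z`
  have hcoord : ∀ z : EuclideanSpace ℝ ι,
      Real.exp (b ⬝ᵥ ofLp (toEuclideanCLM (n := ι) (𝕜 := ℝ) R z) +
        (1/2 : ℝ) * (ofLp (toEuclideanCLM (n := ι) (𝕜 := ℝ) R z) ⬝ᵥ M *ᵥ
          ofLp (toEuclideanCLM (n := ι) (𝕜 := ℝ) R z))) =
      Real.exp ((R *ᵥ b) ⬝ᵥ ofLp z + (1/2 : ℝ) * (ofLp z ⬝ᵥ (R * M * R) *ᵥ ofLp z)) := by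
    intro z
    rw [ofLp_toEuclideanCLM, mulVec_dotProduct_mulVec_mulVec, hRt,
      dotProduct_mulVec_eq_transpose_mulVec_dotProduct, hRt]
  simp_rw [hcoord]
  have hM' : ((1 : Matrix ι ι ℝ) - R * M * R).PosDef := hM
  rw [integral_exp_dotProduct_add_half_quadForm_stdGaussian hM' (R *ᵥ b)]

/-- **[ABKM19] (7.8), shifted quadratic weight under `N(0,C)`**: for a symmetric `A` with
`1 − √C A √C` positive definite and every field `φ`,
`∫ e^{½ (A(φ+ψ))ᵀ(φ+ψ)} N(0,C)(dψ) = (√det(1 − √C A √C))⁻¹ · e^{½ φᵀAφ + ½ (√C Aφ)ᵀ(1−√CA√C)⁻¹(√C Aφ)}`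
(the source writes the exponent as `½((A⁻¹ − C)⁻¹φ, φ)` when `A` is invertible).
[cite: AdamsBuchholzKoteckyMuller2019, Ch. 7.1 (7.8)] -/
theorem integral_exp_half_quadForm_shift_multivariateGaussian (C : Matrix ι ι ℝ)
    {A : Matrix ι ι ℝ} (hA : A.IsSymm)
    (hCA : ((1 : Matrix ι ι ℝ) - CFC.sqrt C * A * CFC.sqrt C).PosDef) (φ : ι → ℝ) :
    ∫ ψ, Real.exp ((1/2 : ℝ) * ((φ + ofLp ψ) ⬝ᵥ A *ᵥ (φ + ofLp ψ)))
        ∂(multivariateGaussian 0 C) =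
      (Real.sqrt ((1 : Matrix ι ι ℝ) - CFC.sqrt C * A * CFC.sqrt C).det)⁻¹ *
        Real.exp ((1/2 : ℝ) * (φ ⬝ᵥ A *ᵥ φ) +
          (1/2 : ℝ) * ((CFC.sqrt C *ᵥ (A *ᵥ φ)) ⬝ᵥ
            ((1 : Matrix ι ι ℝ) - CFC.sqrt C * A * CFC.sqrt C)⁻¹ *ᵥ (CFC.sqrt C *ᵥ (A *ᵥ φ)))) := by
  have hAt : Aᵀ = A := hA
  -- expand the square: `½(φ+ψ)ᵀA(φ+ψ) = ½φᵀAφ + (Aφ)ᵀψ + ½ψᵀAψ`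
  have hexp : ∀ ψ : EuclideanSpace ℝ ι,
      Real.exp ((1/2 : ℝ) * ((φ + ofLp ψ) ⬝ᵥ A *ᵥ (φ + ofLp ψ))) =
        Real.exp ((1/2 : ℝ) * (φ ⬝ᵥ A *ᵥ φ)) *
          Real.exp ((A *ᵥ φ) ⬝ᵥ ofLp ψ + (1/2 : ℝ) * (ofLp ψ ⬝ᵥ A *ᵥ ofLp ψ)) := by
    intro ψ
    rw [← Real.exp_add]
    congr 1
    have hcross : ofLp ψ ⬝ᵥ A *ᵥ φ = (A *ᵥ φ) ⬝ᵥ ofLp ψ := dotProduct_comm _ _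
    have hcross' : φ ⬝ᵥ A *ᵥ ofLp ψ = (A *ᵥ φ) ⬝ᵥ ofLp ψ := by
      rw [dotProduct_mulVec_eq_transpose_mulVec_dotProduct, hAt]
    rw [Matrix.mulVec_add, add_dotProduct, dotProduct_add, dotProduct_add, hcross, hcross']
    ring
  simp_rw [hexp]
  rw [integral_const_mul, integral_exp_dotProduct_add_half_quadForm_multivariateGaussian C hCA (A *ᵥ φ),
    Real.exp_add]
  ring

end Literature.MathematicalPhysics.QuantumFieldTheory

end
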